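import Summits.KontsevichZagierPeriods.KontsevichZagierPeriods.Theorems.HurwitzMicroSectorsNormalFormPrincipleSplitMoves
import Summits.KontsevichZagierPeriods.KontsevichZagierPeriods.Theorems.HermiteRigidityGenusTwoCycleTransferPushforwardDimOne

/-!
# `NormalFormPrinciple` (stmt-KontsevichZagierPeriods-3869), line `SketchIdeator1` — registered
# sub-goal `nfA_pole_one` (siege k1, Mathlib-API route): a simple real-algebraic pole off `[0,1]`
# is ONE carrier `Λ(u, c') = [(1,u), c'/y]`

Pure proof file (`--supports` the crux stmt-KontsevichZagierPeriods-3869). The registered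
sub-goal `nfA_pole_one` of the lead's skeleton (algebraic-pole layer of `stub_boxRigidity`): for
real algebraic `c, ρ` with `ρ ∉ [0,1]`, the representation `T = [(0,1), c/(x − ρ)]` is, modulo
`KZ.relations`, the "algebraic normal form" `[pt, r] + Σⱼ Λ(uⱼ, cⱼ)` with
`Λ(u, c) = [(1,u), c/y]` (`RA 1 u c`), `uⱼ > 1` algebraic, `r, cⱼ` algebraic.

The proof is ONE change-of-variables move (rule (2) of [Kontsevich–Zagier 2001, §1.2]) by an
affine chart of `ℝ¹` with algebraic coefficients, `Φ y = s·y + ρ`, from the carrier to `T`: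

* `ρ < 0`: `s = −ρ > 0`, `u = (1 − ρ)/(−ρ)`, `c' = c`: `Φ` maps `(1,u)` onto `(0,1)`
  increasingly and `c'/y = c/(Φ y − ρ) · |s|`;
* `ρ > 1`: `s = 1 − ρ < 0`, `u = ρ/(ρ − 1)`, `c' = −c`: `Φ` maps `(1,u)` onto `(0,1)`
  decreasingly (`Φ 1 = 1`, `Φ u = 0`) and `−c/y = c/(Φ y − ρ) · |s|`.

So `[T] = [RA 1 u c']` in `FormalRep ⧸ relations`, and the point term is `[ZA 0] = 0` (zero
integrand).
We take `r = 0`, `k = 1`. Everything geometric is REUSED from the tree: the affine-chart lemmas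
`aff_hasFDerivAt_chart`, `aff_injective_chart`, `aff_isSemialgebraicMapOn_chart`
(`TerasomaMultiplicationBetaCancellationStubAffineMove.lean`), the slab images of either orientation
`image_affine_slab_of_pos/neg` (`HurwitzMicroSectorsNormalFormPrincipleSplitMoves.lean`) and the
Jacobian `det (s • id_{ℝ¹}) = s` (`det_smul_id_fin_one`,
`HermiteRigidityGenusTwoCycleTransferPushforwardDimOne.lean`, Mathlib's `LinearMap.det_smul`);
the algebra is Mathlib's closure of `IsAlgebraic ℚ` under `−, ·, ⁻¹` and `QuotientAddGroup`.

References: M. Kontsevich, D. Zagier, *Periods* (2001), §1.1–1.2. No definitions are introduced.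
-/

noncomputable section

open MeasureTheory Set
open Literature.NumberTheory.Transcendental Literature.NumberTheory.Transcendental.KZ

namespace Summit.KontsevichZagierPeriods.HurwitzMicroSectors.NormalFormPrinciple.NfAPoleOneK1

open Summit.KontsevichZagierPeriods.KontsevichZagierPeriods.BetaCancellationLine
  (aff_hasFDerivAt_chart aff_injective_chart aff_isSemialgebraicMapOn_chart)
open Summit.KontsevichZagierPeriods.HurwitzMicroSectors.NormalFormPrinciple.PiBox.Dlog
  (image_affine_slab_of_pos image_affine_slab_of_neg)
open Summit.KontsevichZagierPeriods.HermiteRigidity.GenusTwoCycleTransfer (det_smul_id_fin_one)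

/-! ## One affine move of `ℝ¹` with algebraic coefficients and a slope of either sign -/

/-- The pull-back identity of the kernel `c/y` under the chart `y ↦ s·y + t`, Jacobian `s`
included: `c/(s y + t − t) · s = c/y` for `s ≠ 0`. [folklore] -/
theorem div_affine_mul_eq (c t : ℝ) {s : ℝ} (hs : s ≠ 0) (y : ℝ) :
    c / (s * y + t - t) * s = c / y := by
  rw [add_sub_cancel_right, mul_comm s y, ← div_div, div_mul_cancel₀ _ hs]

/-- **One rule-(2) move by an affine chart of `ℝ¹`** with real algebraic coefficients `s ≠ 0`,
`t`: if `T.domain = Φ '' A.domain` for `Φ y = s·y + t` and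
`A.integrand y = T.integrand (Φ y) · |s|` on `A.domain`, then `[A] − [T] ∈ KZ.relations`.
[cite: KontsevichZagier2001, §1.2 rule (2)] -/
theorem of_sub_of_mem_relations_affine {s t : ℝ} (hs : IsAlgebraic ℚ s) (ht : IsAlgebraic ℚ t)
    (hs0 : s ≠ 0) (A T : IntegralRep 1)
    (himage : T.domain = (fun y : Fin 1 → ℝ => fun _ : Fin 1 => s * y 0 + t) '' A.domain)
    (hint : ∀ y ∈ A.domain, A.integrand y = T.integrand (fun _ : Fin 1 => s * y 0 + t) * |s|) :
    of A - of T ∈ relations :=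
  changeOfVariablesRel_subset_relations
    ⟨1, A, T, fun y : Fin 1 → ℝ => fun _ : Fin 1 => s * y 0 + t,
      fun _ => s • ContinuousLinearMap.id ℝ (Fin 1 → ℝ),
      aff_isSemialgebraicMapOn_chart A.isSemialgebraic_domain ht hs,
      fun x _ => (aff_hasFDerivAt_chart s t x).hasFDerivWithinAt,
      (aff_injective_chart hs0 t).injOn, himage,
      fun x hx => by rw [hint x hx, det_smul_id_fin_one], rfl⟩

/-! ## The registered sub-goal -/

/-- **Registered sub-goal `nfA_pole_one`** (crux stmt-KontsevichZagierPeriods-3869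
`NormalFormPrinciple`, line `SketchIdeator1`, algebraic-pole layer of `stub_boxRigidity`): for
real algebraic `c`, `ρ` with `ρ ∉ [0,1]`, a representation `T = [(0,1), c/(x − ρ)]` equals, in
`FormalRep ⧸ relations`, a point term `[ZA r]` plus a sum of carriers
`[RA 1 uⱼ cⱼ] = [(1,uⱼ), cⱼ/y]` with `uⱼ > 1` and `r, uⱼ, cⱼ` real algebraic. Witness: `r = 0`,
ONE carrier —
`u = (1−ρ)/(−ρ)`, `c' = c` if `ρ < 0`; `u = ρ/(ρ−1)`, `c' = −c` if `ρ > 1` — reached by the single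
affine substitution `x = s·y + ρ` (`s = −ρ`, resp. `s = 1 − ρ`).
[cite: KontsevichZagier2001, §1.2 rule (2)] -/
theorem nfA_pole_one {RA : ℝ → ℝ → ℝ → IntegralRep 1} {ZA : ℝ → IntegralRep 0} (hR : ∀ a b c, IsAlgebraic ℚ a → IsAlgebraic ℚ b → IsAlgebraic ℚ c → 0 < a → (RA a b c).domain = {x | x 0 ∈ Set.Ioo a b} ∧ (RA a b c).integrand = fun x => c / x 0) (hZ : ∀ r, IsAlgebraic ℚ r → (ZA r).domain = univ ∧ (ZA r).integrand = fun _ => r) {c ρ : ℝ} (hc : IsAlgebraic ℚ c) (hρA : IsAlgebraic ℚ ρ) (hρ : ρ ∉ Set.Icc (0:ℝ) 1) (T : IntegralRep 1) (hTd : T.domain = {x | x 0 ∈ Set.Ioo (0:ℝ) 1}) (hTi : EqOn T.integrand (fun x => c / (x 0 - ρ)) T.domain) : ∃ (r : ℝ) (k : ℕ) (u c : Fin k → ℝ), IsAlgebraic ℚ r ∧ (∀ j, 1 < u j) ∧ (∀ j, IsAlgebraic ℚ (u j)) ∧ (∀ j, IsAlgebraic ℚ (c j)) ∧ QuotientAddGroup.mk'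 relations (of T) = QuotientAddGroup.mk' relations (of (ZA r)) + ∑ j, QuotientAddGroup.mk' relations (of (RA 1 (u j) (c j))) := by
  -- it suffices to produce ONE carrier `RA 1 u c'` with `[RA 1 u c'] − [T] ∈ relations`
  suffices h : ∃ u c' : ℝ, 1 < u ∧ IsAlgebraic ℚ u ∧ IsAlgebraic ℚ c' ∧
      of (RA 1 u c') - of T ∈ relations by
    obtain ⟨u, c', hu1, hu, hc', hrel⟩ := h
    have hZ0 : of (ZA 0) ∈ relations :=
      of_mem_relations_of_eqOn_zero (ZA 0) fun x _ => by rw [(hZ 0 isAlgebraic_zero).2]; rfl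
    refine ⟨0, 1, fun _ => u, fun _ => c', isAlgebraic_zero, fun _ => hu1, fun _ => hu,
      fun _ => hc', ?_⟩
    rw [Fin.sum_univ_one, QuotientAddGroup.mk'_apply, QuotientAddGroup.mk'_apply,
      QuotientAddGroup.mk'_apply, (QuotientAddGroup.eq_zero_iff _).mpr hZ0, zero_add, eq_comm,
      QuotientAddGroup.eq_iff_sub_mem]
    exact hrel
  rcases lt_or_ge ρ 0 with hρ0 | hρ0
  · -- `ρ < 0`: slope `s = −ρ > 0`, `u = (1 − ρ)/(−ρ)`, `c' = c`
    have hs : 0 < -ρ := neg_pos.mpr hρ0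
    have hu1 : 1 < (1 - ρ) / (-ρ) := by rw [one_lt_div hs]; linarith
    have hu : IsAlgebraic ℚ ((1 - ρ) / (-ρ)) := by
      rw [div_eq_mul_inv]; exact (isAlgebraic_one.sub hρA).mul hρA.neg.inv
    obtain ⟨hAd, hAi⟩ := hR 1 ((1 - ρ) / (-ρ)) c isAlgebraic_one hu hc one_pos
    refine ⟨(1 - ρ) / (-ρ), c, hu1, hu, hc, of_sub_of_mem_relations_affine hρA.neg hρA hs.ne'
      (RA 1 ((1 - ρ) / (-ρ)) c) T ?_ fun y hy => ?_⟩
    · -- the chart maps `(1, u)` onto `(0, 1)`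
      have e1 : -ρ * 1 + ρ = 0 := by ring
      have hρne : ρ ≠ 0 := hρ0.ne
      have e2 : -ρ * ((1 - ρ) / (-ρ)) + ρ = 1 := by
        field_simp
        ring
      rw [hAd, hTd, image_affine_slab_of_pos hs ρ, e1, e2]
    · -- the pull-back identity `c/y = c/((−ρ) y + ρ − ρ) · |−ρ|`
      have hy1 : 1 < y 0 := by rw [hAd] at hy; exact hy.1
      have hΦy : (fun _ : Fin 1 => -ρ * y 0 + ρ) ∈ T.domain := by
        rw [hTd]
        simp only [mem_setOf_eq, mem_Ioo]
        have hy2 : y 0 < (1 - ρ) / (-ρ) := by rw [hAd] at hy; exact hy.2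
        rw [lt_div_iff₀ hs] at hy2
        constructor <;> nlinarith
      rw [hAi, hTi hΦy, abs_of_pos hs]
      exact (div_affine_mul_eq c ρ hs.ne' (y 0)).symm
  · -- `ρ > 1`: slope `s = 1 − ρ < 0`, `u = ρ/(ρ − 1)`, `c' = −c`
    have hρ1 : 1 < ρ := by
      by_contra h
      exact hρ ⟨hρ0, not_lt.mp h⟩
    have hs : 1 - ρ < 0 := by linarith
    have hρ1' : 0 < ρ - 1 := by linarith
    have hu1 : 1 < ρ / (ρ - 1) := by rw [one_lt_div hρ1']; linarith
    have hu : IsAlgebraic ℚ (ρ / (ρ - 1)) := by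
      rw [div_eq_mul_inv]; exact hρA.mul (hρA.sub isAlgebraic_one).inv
    obtain ⟨hAd, hAi⟩ := hR 1 (ρ / (ρ - 1)) (-c) isAlgebraic_one hu hc.neg one_pos
    refine ⟨ρ / (ρ - 1), -c, hu1, hu, hc.neg, of_sub_of_mem_relations_affine
      (isAlgebraic_one.sub hρA) hρA hs.ne (RA 1 (ρ / (ρ - 1)) (-c)) T ?_ fun y hy => ?_⟩
    · -- the chart maps `(1, u)` onto `(0, 1)`, reversing the orientation
      have e1 : (1 - ρ) * (ρ / (ρ - 1)) + ρ = 0 := by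
        field_simp
        ring
      have e2 : (1 - ρ) * 1 + ρ = 1 := by ring
      rw [hAd, hTd, image_affine_slab_of_neg hs ρ, e1, e2]
    · -- the pull-back identity `−c/y = c/((1−ρ) y + ρ − ρ) · |1 − ρ|`
      have hy1 : 1 < y 0 := by rw [hAd] at hy; exact hy.1
      have hΦy : (fun _ : Fin 1 => (1 - ρ) * y 0 + ρ) ∈ T.domain := by
        rw [hTd]
        simp only [mem_setOf_eq, mem_Ioo]
        have hy2 : y 0 < ρ / (ρ - 1) := by rw [hAd] at hy; exact hy.2
        rw [lt_div_iff₀ hρ1'] at hy2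
        constructor <;> nlinarith
      rw [hAi, hTi hΦy, abs_of_neg hs]
      show -c / y 0 = c / ((1 - ρ) * y 0 + ρ - ρ) * -(1 - ρ)
      rw [mul_neg, div_affine_mul_eq c ρ hs.ne (y 0), neg_div]

end Summit.KontsevichZagierPeriods.HurwitzMicroSectors.NormalFormPrinciple.NfAPoleOneK1
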